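import Mathlib
import HarnessLib
import Literature.MathematicalPhysics.QuantumLattice.HubbardSliceSymbolSmoothXiThird
import Summits.HubbardSuperconductivity.HubbardSuperconductivity.Theorems.KLProgrammeC4aPPKernelTrueNumeratorC2

/-!
# Route `KLProgramme` — crux C4a, S3 brick (B4) «(B4)-UMK1», «(U1)-M-LAW» kernel side: the THIRD partner-level derivative `∂ᵤ³N` of the true numerator —
# part 1: the third level derivative of the weight, the series `ppTrueNumeratorDuuu` and termwise differentiation `∂ᵤ(∂ᵤ²N) = ∂ᵤ³N`

Cell `gate-hubbard-kl`, seat hubbard-kl-k3c3-p1 (g17; row «δμ-flow with klAngularMean constant piece»).  Kernel rows for k3c3-p3's «(U1)-M-LAW» (pen (R384)(A)(a);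
5b-M `…C4aPreCausticLevelLineMiddle`, binder `hK2 : |∂ᵤ²K| ≤ 1/max(e,|u|)³`): the comparable-levels piece `M` of the true pp kernel contains the anti-diagonal
`u = −e`, where `P = N(e,u)/(e+u)` is smooth only through the cancellation `N(e,−e) = 0`; its SECOND derivative there is controlled by the THIRD derivative of
`N` (`∂ᵤ²[N/(e+u)] = ψ₂(u)/(e+u)³`, `ψ₂ = ∂ᵤ²N·(e+u)² − 2∂ᵤN·(e+u) + 2N`, `ψ₂(−e) = 0`, `ψ₂′ = ∂ᵤ³N·(e+u)²`).  This file is `…TrueNumeratorD2` one order up: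
* §1 `hasDerivAt_lorentzian_deriv2` (`L‴(ω,x) = (36ω²x² − 6x⁴ − 6ω⁴)/(ω²+x²)⁴`), `abs_lorentzian_deriv3_le` (`≤ 18/(ω²+x²)²`), def **`uvWeightFnD3`** (the third level
  derivative of the above-scale weight), `hasDerivAt_uvWeightFnD2`, `uvWeightFnD3_eq_zero_of_lt/_of_gt`, `abs_uvWeightFnD3_le_shell` (`≤ ((8B₃+12B₂)/Λ³)·2Λ²/(ω²+Λ²)`);
* §2 `abs_ppDuuSummand_le` (the dominator of `∂ᵤ²N`'s summand, exported), def **`ppTrueNumeratorDuuu`**, `abs_ppDuuuSummand_le`, **`hasDerivAt_ppTrueNumeratorDuu_u`**.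
Part 2 (`…TrueNumeratorD3Bounds`): the far bound `9/|u|³`, the uniform bound `(32B₃+96B₂+312B₁+180)/Λ³`, the scale form.
Pure real analysis; nothing asserts (C), K3, the window or superconductivity.
References: BGM 2006 §2.4 (2.36) [cite: BenfattoGiulianiMastropietro2006]; Salmhofer 1999 §4.2.5 (4.70)–(4.71) [cite: Salmhofer1999].
-/

noncomputable section

namespace Summit.HubbardSuperconductivity.HubbardSuperconductivity.Theorems.C4a

set_option linter.dupNamespace false -- summit = problem name (single-conjunct summit), D-0017

open Real Filter Set
open scoped Topology
open Literature.MathematicalPhysics.QuantumLattice Literature.Analysis.SpecialFunctions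

/-! ## §1 One-line facts: `L‴` and the third level derivative of the weight -/

/-- `d/dx[2x(x²−3ω²)/(ω²+x²)³] = (36ω²x² − 6x⁴ − 6ω⁴)/(ω²+x²)⁴` (`ω²+x² ≠ 0`). [folklore] -/
theorem hasDerivAt_lorentzian_deriv2 (ω : ℝ) {x : ℝ} (h : ω ^ 2 + x ^ 2 ≠ 0) :
    HasDerivAt (fun y : ℝ => 2 * y * (y ^ 2 - 3 * ω ^ 2) / (ω ^ 2 + y ^ 2) ^ 3) ((36 * ω ^ 2 * x ^ 2 - 6 * x ^ 4 - 6 * ω ^ 4) / (ω ^ 2 + x ^ 2) ^ 4) x := by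
  have h1 : HasDerivAt (fun y : ℝ => 2 * y * (y ^ 2 - 3 * ω ^ 2)) (2 * (x ^ 2 - 3 * ω ^ 2) + 2 * x * (2 * x)) x := by
    have ha : HasDerivAt (fun y : ℝ => 2 * y) 2 x := by simpa using (hasDerivAt_id x).const_mul 2
    have hb : HasDerivAt (fun y : ℝ => y ^ 2 - 3 * ω ^ 2) (2 * x) x := by
      have h0 := (hasDerivAt_pow 2 x).sub_const (3 * ω ^ 2)
      refine h0.congr_deriv ?_
      simp
    have h := ha.mul hb
    refine h.congr_deriv ?_
    ring
  have h2 : HasDerivAt (fun y : ℝ => (ω ^ 2 + y ^ 2) ^ 3) (3 * (ω ^ 2 + x ^ 2) ^ 2 * (2 * x)) x := by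
    have h0 := ((hasDerivAt_pow 2 x).const_add (ω ^ 2)).pow 3
    refine h0.congr_deriv ?_
    simp
  have h := h1.div h2 (pow_ne_zero 3 h)
  refine h.congr_deriv ?_
  field_simp
  ring

/-- `|L‴(ω,x)| ≤ 18/(ω²+x²)²`. [folklore] -/
theorem abs_lorentzian_deriv3_le (ω x : ℝ) (h : 0 < ω ^ 2 + x ^ 2) :
    |(36 * ω ^ 2 * x ^ 2 - 6 * x ^ 4 - 6 * ω ^ 4) / (ω ^ 2 + x ^ 2) ^ 4| ≤ 18 / (ω ^ 2 + x ^ 2) ^ 2 := by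
  rw [abs_div, abs_of_pos (pow_pos h 4), div_le_div_iff₀ (pow_pos h 4) (pow_pos h 2)]
  have h1 : |36 * ω ^ 2 * x ^ 2 - 6 * x ^ 4 - 6 * ω ^ 4| ≤ 18 * (ω ^ 2 + x ^ 2) ^ 2 := by
    rw [abs_le]; constructor <;> nlinarith [sq_nonneg x, sq_nonneg ω, sq_nonneg (x ^ 2), sq_nonneg (ω ^ 2), mul_nonneg (sq_nonneg ω) (sq_nonneg x)]
  calc |36 * ω ^ 2 * x ^ 2 - 6 * x ^ 4 - 6 * ω ^ 4| * (ω ^ 2 + x ^ 2) ^ 2 ≤ 18 * (ω ^ 2 + x ^ 2) ^ 2 * (ω ^ 2 + x ^ 2) ^ 2 := by gcongr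
    _ = 18 * (ω ^ 2 + x ^ 2) ^ 4 := by ring

/-- `|L‴(ω,x)| ≤ 18/ω⁴` for `ω > 0`. [folklore] -/
theorem abs_lorentzian_deriv3_le_pow {ω : ℝ} (hω : 0 < ω) (x : ℝ) : |(36 * ω ^ 2 * x ^ 2 - 6 * x ^ 4 - 6 * ω ^ 4) / (ω ^ 2 + x ^ 2) ^ 4| ≤ 18 / ω ^ 4 := by
  have h : 0 < ω ^ 2 + x ^ 2 := by positivity
  refine (abs_lorentzian_deriv3_le ω x h).trans ?_
  exact div_le_div_of_nonneg_left (by norm_num) (by positivity) (by nlinarith [sq_nonneg x, pow_pos hω 2])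

/-- The third level derivative of the above-scale weight `W(ω,x) = χ₂((x²+ω²)/Λ²)`: `χ₂‴(q)(2x/Λ²)³ + 3χ₂″(q)(2x/Λ²)(2/Λ²)`, `q = (x²+ω²)/Λ²`.
[cite: Salmhofer1999, §4.2.5 (4.70)] -/
def uvWeightFnD3 (Λ e ω : ℝ) : ℝ :=
  deriv (deriv (deriv salmhoferCutoff)) ((ω ^ 2 + e ^ 2) / Λ ^ 2) * (2 * ω / Λ ^ 2) * (2 * ω / Λ ^ 2) * (2 * ω / Λ ^ 2) +
    3 * (deriv (deriv salmhoferCutoff) ((ω ^ 2 + e ^ 2) / Λ ^ 2) * (2 * ω / Λ ^ 2) * (2 / Λ ^ 2))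

/-- `W‴ = uvWeightFnD3`. [cite: Salmhofer1999, §4.2.5 (4.70)] -/
theorem hasDerivAt_uvWeightFnD2 (Λ e ω : ℝ) : HasDerivAt (uvWeightFnD2 Λ e) (uvWeightFnD3 Λ e ω) ω := by
  unfold uvWeightFnD2 uvWeightFnD3
  exact hasDerivAt_deriv2_term Λ e ω

/-- Below the shell the third derivative vanishes: `ω² + x² < Λ²/4 ⟹ W‴(ω,x) = 0`. [cite: Salmhofer1999, §4.2.5 (4.71)] -/
theorem uvWeightFnD3_eq_zero_of_lt {Λ : ℝ} (hΛ : 0 < Λ) {ω x : ℝ} (h : x ^ 2 + ω ^ 2 < Λ ^ 2 / 4) : uvWeightFnD3 Λ ω x = 0 := by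
  have h1 : (x ^ 2 + ω ^ 2) / Λ ^ 2 < 1 / 4 := by rw [div_lt_iff₀ (by positivity)]; linarith
  unfold uvWeightFnD3
  rw [deriv_deriv_deriv_salmhoferCutoff_eq_zero_of_lt h1, deriv_deriv_salmhoferCutoff_eq_zero_of_lt h1]
  ring

/-- Above the shell the third derivative vanishes: `Λ² < ω² + x² ⟹ W‴(ω,x) = 0`. [cite: Salmhofer1999, §4.2.5 (4.71)] -/
theorem uvWeightFnD3_eq_zero_of_gt {Λ : ℝ} (hΛ : 0 < Λ) {ω x : ℝ} (h : Λ ^ 2 < x ^ 2 + ω ^ 2) : uvWeightFnD3 Λ ω x = 0 := by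
  have h1 : 1 < (x ^ 2 + ω ^ 2) / Λ ^ 2 := by rw [lt_div_iff₀ (by positivity)]; linarith
  unfold uvWeightFnD3
  rw [deriv_deriv_deriv_salmhoferCutoff_eq_zero_of_gt h1, deriv_deriv_salmhoferCutoff_eq_zero_of_gt h1]
  ring

/-- **Shell bound for `W‴`**: `|W‴(ω,x)| ≤ ((8B₃+12B₂)/Λ³)·(2Λ²/(ω²+Λ²))`. [cite: Salmhofer1999, §4.2.5 (4.71)] -/
theorem abs_uvWeightFnD3_le_shell {B₂ B₃ : ℝ} (hB₂ : ∀ x, |deriv (deriv salmhoferCutoff) x| ≤ B₂) (hB₃ : ∀ x, |deriv (deriv (deriv salmhoferCutoff)) x| ≤ B₃)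
    {Λ : ℝ} (hΛ : 0 < Λ) (ω x : ℝ) : |uvWeightFnD3 Λ ω x| ≤ (8 * B₃ + 12 * B₂) / Λ ^ 3 * (2 * Λ ^ 2 / (ω ^ 2 + Λ ^ 2)) := by
  have hB20 : 0 ≤ B₂ := (abs_nonneg _).trans (hB₂ 0)
  have hB30 : 0 ≤ B₃ := (abs_nonneg _).trans (hB₃ 0)
  by_cases h : Λ ^ 2 < x ^ 2 + ω ^ 2
  · rw [uvWeightFnD3_eq_zero_of_gt hΛ h, abs_zero]; positivity
  · have hωΛ : ω ^ 2 ≤ Λ ^ 2 := by nlinarith [not_lt.1 h, sq_nonneg x]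
    have h1 : |uvWeightFnD3 Λ ω x| ≤ (8 * B₃ + 12 * B₂) / Λ ^ 3 := by
      unfold uvWeightFnD3; exact abs_deriv3_term_le hB₂ hB₃ hΛ ω x
    have h2 : 1 ≤ 2 * Λ ^ 2 / (ω ^ 2 + Λ ^ 2) := by rw [le_div_iff₀ (by positivity)]; nlinarith
    calc |uvWeightFnD3 Λ ω x| ≤ (8 * B₃ + 12 * B₂) / Λ ^ 3 * 1 := by rw [mul_one]; exact h1
      _ ≤ (8 * B₃ + 12 * B₂) / Λ ^ 3 * (2 * Λ ^ 2 / (ω ^ 2 + Λ ^ 2)) := mul_le_mul_of_nonneg_left h2 (by positivity)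

/-- The shell factor is at most `2`. [folklore] -/
theorem shellFactor_le_two {Λ : ℝ} (hΛ : 0 < Λ) (ω : ℝ) : 2 * Λ ^ 2 / (ω ^ 2 + Λ ^ 2) ≤ 2 := by
  rw [div_le_iff₀ (by positivity)]; nlinarith [sq_nonneg ω]

/-! ## §2 The third derivative series -/

/-- **The dominator of `∂ᵤ²N`'s summand** (exported form of the bound inside `hasDerivAt_ppTrueNumeratorDu_u`): with `S = 2Λ²/(ωₙ²+Λ²)`,
`|W_e·(W″(L_e+L_v) + 2W′L′ + WL″)| ≤ a·S + b·S + c/ωₙ²`, `a = ((4B₂+2B₁)/Λ²)(|e|(β/π)²+β/π)`, `b = 2(2B₁/Λ)(β/π)²`, `c = 3β/π`. [folklore] -/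
theorem abs_ppDuuSummand_le {β Λ : ℝ} (hβ : 0 < β) (hΛ : 0 < Λ) {B₁ B₂ : ℝ} (hB₁ : ∀ x, |deriv salmhoferCutoff x| ≤ B₁)
    (hB₂ : ∀ x, |deriv (deriv salmhoferCutoff) x| ≤ B₂) (e v : ℝ) (n : ℕ) :
    |uvWeightFn Λ (ppFreq β n) e *
      (uvWeightFnD2 Λ (ppFreq β n) v * (e / (ppFreq β n ^ 2 + e ^ 2) + v / (ppFreq β n ^ 2 + v ^ 2)) +
        2 * uvWeightFnD1 Λ (ppFreq β n) v * ((ppFreq β n ^ 2 - v ^ 2) / (ppFreq β n ^ 2 + v ^ 2) ^ 2) +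
        uvWeightFn Λ (ppFreq β n) v * (2 * v * (v ^ 2 - 3 * ppFreq β n ^ 2) / (ppFreq β n ^ 2 + v ^ 2) ^ 3))| ≤
      (4 * B₂ + 2 * B₁) / Λ ^ 2 * (|e| * (β / π) ^ 2 + β / π) * (2 * Λ ^ 2 / (ppFreq β n ^ 2 + Λ ^ 2)) +
        2 * (2 * B₁ / Λ) * (β / π) ^ 2 * (2 * Λ ^ 2 / (ppFreq β n ^ 2 + Λ ^ 2)) + 3 * (β / π) * (1 / (ppFreq β n ^ 2 + 0 ^ 2)) := by
  have hB0 := salmhoferB₁_nonneg hB₁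
  have hB20 : 0 ≤ B₂ := (abs_nonneg _).trans (hB₂ 0)
  have hω : ∀ n : ℕ, 0 < ppFreq β n := ppFreq_pos hβ
  have hωπ := inv_ppFreq_le hβ
  have hLe : |e / (ppFreq β n ^ 2 + e ^ 2)| ≤ |e| * (β / π) ^ 2 := by
    refine (abs_lorentzian_le_abs_div_sq (hω n).ne' e).trans ?_
    rw [div_eq_mul_one_div]
    refine mul_le_mul_of_nonneg_left ?_ (abs_nonneg e)
    calc 1 / ppFreq β n ^ 2 = (1 / ppFreq β n) ^ 2 := by rw [one_div_pow]
      _ ≤ (β / π) ^ 2 := pow_le_pow_left₀ (by have := hω n; positivity) (hωπ n) 2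
  have hLv : |v / (ppFreq β n ^ 2 + v ^ 2)| ≤ β / π :=
    (abs_lorentzian_le_half_inv (hω n) v).trans (by
      calc 1 / (2 * ppFreq β n) = (1 / ppFreq β n) / 2 := by field_simp
        _ ≤ (β / π) / 2 := by have := hωπ n; linarith
        _ ≤ β / π := by linarith [show 0 < β / π by positivity])
  have hL1 : |(ppFreq β n ^ 2 - v ^ 2) / (ppFreq β n ^ 2 + v ^ 2) ^ 2| ≤ (β / π) ^ 2 := by
    refine (abs_lorentzian_deriv_le_inv (by have := hω n; positivity)).trans ?_
    calc 1 / (ppFreq β n ^ 2 + v ^ 2) ≤ 1 / ppFreq β n ^ 2 := one_div_le_one_div_of_le (pow_pos (hω n) 2) (by nlinarith [sq_nonneg v])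
      _ = (1 / ppFreq β n) ^ 2 := by rw [one_div_pow]
      _ ≤ (β / π) ^ 2 := pow_le_pow_left₀ (by have := hω n; positivity) (hωπ n) 2
  have hL2 : |2 * v * (v ^ 2 - 3 * ppFreq β n ^ 2) / (ppFreq β n ^ 2 + v ^ 2) ^ 3| ≤ 3 * (β / π) * (1 / (ppFreq β n ^ 2 + 0 ^ 2)) := by
    refine (abs_lorentzian_deriv2_le_cube (hω n) v).trans ?_
    rw [zero_pow two_ne_zero, add_zero]
    have h0 : 0 ≤ 1 / ppFreq β n ^ 2 := by have := hω n; positivity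
    calc 3 / ppFreq β n ^ 3 = 3 * (1 / ppFreq β n) * (1 / ppFreq β n ^ 2) := by field_simp
      _ ≤ 3 * (β / π) * (1 / ppFreq β n ^ 2) := mul_le_mul_of_nonneg_right (mul_le_mul_of_nonneg_left (hωπ n) (by norm_num)) h0
  have hWe : |uvWeightFn Λ (ppFreq β n) e| ≤ 1 := abs_uvWeightFn_le_one _ _ _
  have hWv : |uvWeightFn Λ (ppFreq β n) v| ≤ 1 := abs_uvWeightFn_le_one _ _ _
  have hD1 := abs_uvWeightFnD1_le_shell hB₁ hΛ (ppFreq β n) v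
  have hD2 := abs_uvWeightFnD2_le_shell hB₁ hB₂ hΛ (ppFreq β n) v
  rw [abs_mul]
  have hsum : |e / (ppFreq β n ^ 2 + e ^ 2) + v / (ppFreq β n ^ 2 + v ^ 2)| ≤ |e| * (β / π) ^ 2 + β / π :=
    (abs_add_le _ _).trans (add_le_add hLe hLv)
  have hp1 : |uvWeightFnD2 Λ (ppFreq β n) v * (e / (ppFreq β n ^ 2 + e ^ 2) + v / (ppFreq β n ^ 2 + v ^ 2))| ≤
      (4 * B₂ + 2 * B₁) / Λ ^ 2 * (2 * Λ ^ 2 / (ppFreq β n ^ 2 + Λ ^ 2)) * (|e| * (β / π) ^ 2 + β / π) := by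
    rw [abs_mul]; exact mul_le_mul hD2 hsum (abs_nonneg _) (by positivity)
  have hp2 : |2 * uvWeightFnD1 Λ (ppFreq β n) v * ((ppFreq β n ^ 2 - v ^ 2) / (ppFreq β n ^ 2 + v ^ 2) ^ 2)| ≤
      2 * (2 * B₁ / Λ * (2 * Λ ^ 2 / (ppFreq β n ^ 2 + Λ ^ 2))) * (β / π) ^ 2 := by
    rw [abs_mul, abs_mul, abs_of_pos (by norm_num : (0 : ℝ) < 2)]
    exact mul_le_mul (mul_le_mul_of_nonneg_left hD1 (by norm_num)) hL1 (abs_nonneg _) (by positivity)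
  have hp3 : |uvWeightFn Λ (ppFreq β n) v * (2 * v * (v ^ 2 - 3 * ppFreq β n ^ 2) / (ppFreq β n ^ 2 + v ^ 2) ^ 3)| ≤
      1 * (3 * (β / π) * (1 / (ppFreq β n ^ 2 + 0 ^ 2))) := by
    rw [abs_mul]; exact mul_le_mul hWv hL2 (abs_nonneg _) zero_le_one
  calc |uvWeightFn Λ (ppFreq β n) e| * |uvWeightFnD2 Λ (ppFreq β n) v * (e / (ppFreq β n ^ 2 + e ^ 2) + v / (ppFreq β n ^ 2 + v ^ 2)) +
        2 * uvWeightFnD1 Λ (ppFreq β n) v * ((ppFreq β n ^ 2 - v ^ 2) / (ppFreq β n ^ 2 + v ^ 2) ^ 2) +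
        uvWeightFn Λ (ppFreq β n) v * (2 * v * (v ^ 2 - 3 * ppFreq β n ^ 2) / (ppFreq β n ^ 2 + v ^ 2) ^ 3)|
      ≤ 1 * ((4 * B₂ + 2 * B₁) / Λ ^ 2 * (2 * Λ ^ 2 / (ppFreq β n ^ 2 + Λ ^ 2)) * (|e| * (β / π) ^ 2 + β / π) +
          2 * (2 * B₁ / Λ * (2 * Λ ^ 2 / (ppFreq β n ^ 2 + Λ ^ 2))) * (β / π) ^ 2 + 1 * (3 * (β / π) * (1 / (ppFreq β n ^ 2 + 0 ^ 2)))) :=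
        mul_le_mul hWe ((abs_add_le _ _).trans (add_le_add ((abs_add_le _ _).trans (add_le_add hp1 hp2)) hp3)) (abs_nonneg _) zero_le_one
    _ = _ := by ring

/-- `∂ᵤ³N(e,u) = (2/β)Σ W(ωₙ,e)[W‴(ωₙ,u)(L_e+L_u) + 3W″(ωₙ,u)L′(ωₙ,u) + 3W′(ωₙ,u)L″(ωₙ,u) + W(ωₙ,u)L‴(ωₙ,u)]`. -/
def ppTrueNumeratorDuuu (β Λ e u : ℝ) : ℝ :=
  2 / β * ∑' n : ℕ, uvWeightFn Λ (ppFreq β n) e *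
    (uvWeightFnD3 Λ (ppFreq β n) u * (e / (ppFreq β n ^ 2 + e ^ 2) + u / (ppFreq β n ^ 2 + u ^ 2)) +
      3 * uvWeightFnD2 Λ (ppFreq β n) u * ((ppFreq β n ^ 2 - u ^ 2) / (ppFreq β n ^ 2 + u ^ 2) ^ 2) +
      3 * uvWeightFnD1 Λ (ppFreq β n) u * (2 * u * (u ^ 2 - 3 * ppFreq β n ^ 2) / (ppFreq β n ^ 2 + u ^ 2) ^ 3) +
      uvWeightFn Λ (ppFreq β n) u * ((36 * ppFreq β n ^ 2 * u ^ 2 - 6 * u ^ 4 - 6 * ppFreq β n ^ 4) / (ppFreq β n ^ 2 + u ^ 2) ^ 4))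

/-- **The dominator of `∂ᵤ³N`'s summand**: with `S = 2Λ²/(ωₙ²+Λ²)`, `|·| ≤ a·S + b·S + c/ωₙ²`, `a = ((8B₃+12B₂)/Λ³)(|e|(β/π)²+β/π)`, `b = 3((4B₂+2B₁)/Λ²)(β/π)²`,
`c = 3(4B₁/Λ)(3β/π) + 18(β/π)²`. [folklore] -/
theorem abs_ppDuuuSummand_le {β Λ : ℝ} (hβ : 0 < β) (hΛ : 0 < Λ) {B₁ B₂ B₃ : ℝ} (hB₁ : ∀ x, |deriv salmhoferCutoff x| ≤ B₁)
    (hB₂ : ∀ x, |deriv (deriv salmhoferCutoff) x| ≤ B₂) (hB₃ : ∀ x, |deriv (deriv (deriv salmhoferCutoff)) x| ≤ B₃) (e v : ℝ) (n : ℕ) :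
    |uvWeightFn Λ (ppFreq β n) e *
      (uvWeightFnD3 Λ (ppFreq β n) v * (e / (ppFreq β n ^ 2 + e ^ 2) + v / (ppFreq β n ^ 2 + v ^ 2)) +
        3 * uvWeightFnD2 Λ (ppFreq β n) v * ((ppFreq β n ^ 2 - v ^ 2) / (ppFreq β n ^ 2 + v ^ 2) ^ 2) +
        3 * uvWeightFnD1 Λ (ppFreq β n) v * (2 * v * (v ^ 2 - 3 * ppFreq β n ^ 2) / (ppFreq β n ^ 2 + v ^ 2) ^ 3) +
        uvWeightFn Λ (ppFreq β n) v * ((36 * ppFreq β n ^ 2 * v ^ 2 - 6 * v ^ 4 - 6 * ppFreq β n ^ 4) / (ppFreq β n ^ 2 + v ^ 2) ^ 4))| ≤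
      (8 * B₃ + 12 * B₂) / Λ ^ 3 * (|e| * (β / π) ^ 2 + β / π) * (2 * Λ ^ 2 / (ppFreq β n ^ 2 + Λ ^ 2)) +
        3 * ((4 * B₂ + 2 * B₁) / Λ ^ 2) * (β / π) ^ 2 * (2 * Λ ^ 2 / (ppFreq β n ^ 2 + Λ ^ 2)) +
        (3 * (4 * B₁ / Λ) * (3 * (β / π)) + 18 * (β / π) ^ 2) * (1 / (ppFreq β n ^ 2 + 0 ^ 2)) := by
  have hB0 := salmhoferB₁_nonneg hB₁
  have hB20 : 0 ≤ B₂ := (abs_nonneg _).trans (hB₂ 0)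
  have hB30 : 0 ≤ B₃ := (abs_nonneg _).trans (hB₃ 0)
  have hω : ∀ n : ℕ, 0 < ppFreq β n := ppFreq_pos hβ
  have hωπ := inv_ppFreq_le hβ
  set ω := ppFreq β n with hωdef
  have hω0 : 0 < ω := hω n
  have hS2 : 2 * Λ ^ 2 / (ω ^ 2 + Λ ^ 2) ≤ 2 := shellFactor_le_two hΛ ω
  have hS0 : 0 ≤ 2 * Λ ^ 2 / (ω ^ 2 + Λ ^ 2) := by positivity
  have hinv2 : 1 / ω ^ 2 ≤ (β / π) ^ 2 := by
    calc 1 / ω ^ 2 = (1 / ω) ^ 2 := by rw [one_div_pow]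
      _ ≤ (β / π) ^ 2 := pow_le_pow_left₀ (by positivity) (hωπ n) 2
  have hLe : |e / (ω ^ 2 + e ^ 2)| ≤ |e| * (β / π) ^ 2 := by
    refine (abs_lorentzian_le_abs_div_sq hω0.ne' e).trans ?_
    rw [div_eq_mul_one_div]
    exact mul_le_mul_of_nonneg_left hinv2 (abs_nonneg e)
  have hLv : |v / (ω ^ 2 + v ^ 2)| ≤ β / π :=
    (abs_lorentzian_le_half_inv hω0 v).trans (by
      calc 1 / (2 * ω) = (1 / ω) / 2 := by field_simp
        _ ≤ (β / π) / 2 := by have := hωπ n; linarith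
        _ ≤ β / π := by linarith [show 0 < β / π by positivity])
  have hL1 : |(ω ^ 2 - v ^ 2) / (ω ^ 2 + v ^ 2) ^ 2| ≤ (β / π) ^ 2 := by
    refine (abs_lorentzian_deriv_le_inv (by positivity)).trans ?_
    calc 1 / (ω ^ 2 + v ^ 2) ≤ 1 / ω ^ 2 := one_div_le_one_div_of_le (pow_pos hω0 2) (by nlinarith [sq_nonneg v])
      _ ≤ (β / π) ^ 2 := hinv2
  have hL2 : |2 * v * (v ^ 2 - 3 * ω ^ 2) / (ω ^ 2 + v ^ 2) ^ 3| ≤ 3 * (β / π) * (1 / (ω ^ 2 + 0 ^ 2)) := by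
    refine (abs_lorentzian_deriv2_le_cube hω0 v).trans ?_
    rw [zero_pow two_ne_zero, add_zero]
    have h0 : 0 ≤ 1 / ω ^ 2 := by positivity
    calc 3 / ω ^ 3 = 3 * (1 / ω) * (1 / ω ^ 2) := by field_simp
      _ ≤ 3 * (β / π) * (1 / ω ^ 2) := mul_le_mul_of_nonneg_right (mul_le_mul_of_nonneg_left (hωπ n) (by norm_num)) h0
  have hL3 : |(36 * ω ^ 2 * v ^ 2 - 6 * v ^ 4 - 6 * ω ^ 4) / (ω ^ 2 + v ^ 2) ^ 4| ≤ 18 * (β / π) ^ 2 * (1 / (ω ^ 2 + 0 ^ 2)) := by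
    refine (abs_lorentzian_deriv3_le_pow hω0 v).trans ?_
    rw [zero_pow two_ne_zero, add_zero]
    have h0 : 0 ≤ 1 / ω ^ 2 := by positivity
    calc 18 / ω ^ 4 = 18 * (1 / ω ^ 2) * (1 / ω ^ 2) := by field_simp
      _ ≤ 18 * (β / π) ^ 2 * (1 / ω ^ 2) := mul_le_mul_of_nonneg_right (mul_le_mul_of_nonneg_left hinv2 (by norm_num)) h0
  have hWe : |uvWeightFn Λ ω e| ≤ 1 := abs_uvWeightFn_le_one _ _ _
  have hWv : |uvWeightFn Λ ω v| ≤ 1 := abs_uvWeightFn_le_one _ _ _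
  have hD1 := abs_uvWeightFnD1_le_shell hB₁ hΛ ω v
  have hD2 := abs_uvWeightFnD2_le_shell hB₁ hB₂ hΛ ω v
  have hD3 := abs_uvWeightFnD3_le_shell hB₂ hB₃ hΛ ω v
  have hD1' : |uvWeightFnD1 Λ ω v| ≤ 4 * B₁ / Λ := by
    calc |uvWeightFnD1 Λ ω v| ≤ 2 * B₁ / Λ * (2 * Λ ^ 2 / (ω ^ 2 + Λ ^ 2)) := hD1
      _ ≤ 2 * B₁ / Λ * 2 := mul_le_mul_of_nonneg_left hS2 (by positivity)
      _ = 4 * B₁ / Λ := by ring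
  rw [abs_mul]
  have hsum : |e / (ω ^ 2 + e ^ 2) + v / (ω ^ 2 + v ^ 2)| ≤ |e| * (β / π) ^ 2 + β / π := (abs_add_le _ _).trans (add_le_add hLe hLv)
  have hp1 : |uvWeightFnD3 Λ ω v * (e / (ω ^ 2 + e ^ 2) + v / (ω ^ 2 + v ^ 2))| ≤
      (8 * B₃ + 12 * B₂) / Λ ^ 3 * (2 * Λ ^ 2 / (ω ^ 2 + Λ ^ 2)) * (|e| * (β / π) ^ 2 + β / π) := by
    rw [abs_mul]; exact mul_le_mul hD3 hsum (abs_nonneg _) (by positivity)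
  have hp2 : |3 * uvWeightFnD2 Λ ω v * ((ω ^ 2 - v ^ 2) / (ω ^ 2 + v ^ 2) ^ 2)| ≤
      3 * ((4 * B₂ + 2 * B₁) / Λ ^ 2 * (2 * Λ ^ 2 / (ω ^ 2 + Λ ^ 2))) * (β / π) ^ 2 := by
    rw [abs_mul, abs_mul, abs_of_pos (by norm_num : (0 : ℝ) < 3)]
    exact mul_le_mul (mul_le_mul_of_nonneg_left hD2 (by norm_num)) hL1 (abs_nonneg _) (by positivity)
  have hp3 : |3 * uvWeightFnD1 Λ ω v * (2 * v * (v ^ 2 - 3 * ω ^ 2) / (ω ^ 2 + v ^ 2) ^ 3)| ≤ 3 * (4 * B₁ / Λ) * (3 * (β / π) * (1 / (ω ^ 2 + 0 ^ 2))) := by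
    rw [abs_mul, abs_mul, abs_of_pos (by norm_num : (0 : ℝ) < 3)]
    exact mul_le_mul (mul_le_mul_of_nonneg_left hD1' (by norm_num)) hL2 (abs_nonneg _) (by positivity)
  have hp4 : |uvWeightFn Λ ω v * ((36 * ω ^ 2 * v ^ 2 - 6 * v ^ 4 - 6 * ω ^ 4) / (ω ^ 2 + v ^ 2) ^ 4)| ≤ 1 * (18 * (β / π) ^ 2 * (1 / (ω ^ 2 + 0 ^ 2))) := by
    rw [abs_mul]; exact mul_le_mul hWv hL3 (abs_nonneg _) zero_le_one
  calc |uvWeightFn Λ ω e| * |uvWeightFnD3 Λ ω v * (e / (ω ^ 2 + e ^ 2) + v / (ω ^ 2 + v ^ 2)) + 3 * uvWeightFnD2 Λ ω v * ((ω ^ 2 - v ^ 2) / (ω ^ 2 + v ^ 2) ^ 2) +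
        3 * uvWeightFnD1 Λ ω v * (2 * v * (v ^ 2 - 3 * ω ^ 2) / (ω ^ 2 + v ^ 2) ^ 3) +
        uvWeightFn Λ ω v * ((36 * ω ^ 2 * v ^ 2 - 6 * v ^ 4 - 6 * ω ^ 4) / (ω ^ 2 + v ^ 2) ^ 4)|
      ≤ 1 * ((8 * B₃ + 12 * B₂) / Λ ^ 3 * (2 * Λ ^ 2 / (ω ^ 2 + Λ ^ 2)) * (|e| * (β / π) ^ 2 + β / π) +
          3 * ((4 * B₂ + 2 * B₁) / Λ ^ 2 * (2 * Λ ^ 2 / (ω ^ 2 + Λ ^ 2))) * (β / π) ^ 2 + 3 * (4 * B₁ / Λ) * (3 * (β / π) * (1 / (ω ^ 2 + 0 ^ 2))) +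
          1 * (18 * (β / π) ^ 2 * (1 / (ω ^ 2 + 0 ^ 2)))) :=
        mul_le_mul hWe ((abs_add_le _ _).trans (add_le_add ((abs_add_le _ _).trans (add_le_add ((abs_add_le _ _).trans (add_le_add hp1 hp2)) hp3)) hp4))
          (abs_nonneg _) zero_le_one
    _ = _ := by ring

/-- **`∂ᵤ(∂ᵤ²N) = ppTrueNumeratorDuuu`** everywhere (termwise differentiation; `|χ′| ≤ B₁`, `|χ″| ≤ B₂`, `|χ‴| ≤ B₃`). [cite: BenfattoGiulianiMastropietro2006, §2.4 (2.36)] -/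
theorem hasDerivAt_ppTrueNumeratorDuu_u {β Λ : ℝ} (hβ : 0 < β) (hΛ : 0 < Λ) {B₁ B₂ B₃ : ℝ} (hB₁ : ∀ x, |deriv salmhoferCutoff x| ≤ B₁)
    (hB₂ : ∀ x, |deriv (deriv salmhoferCutoff) x| ≤ B₂) (hB₃ : ∀ x, |deriv (deriv (deriv salmhoferCutoff)) x| ≤ B₃) (e u : ℝ) :
    HasDerivAt (fun v => ppTrueNumeratorDuu β Λ e v) (ppTrueNumeratorDuuu β Λ e u) u := by
  have hω : ∀ n : ℕ, 0 < ppFreq β n := ppFreq_pos hβ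
  unfold ppTrueNumeratorDuu ppTrueNumeratorDuuu
  refine HasDerivAt.const_mul (2 / β) ?_
  set a : ℝ := (8 * B₃ + 12 * B₂) / Λ ^ 3 * (|e| * (β / π) ^ 2 + β / π) with ha
  set b : ℝ := 3 * ((4 * B₂ + 2 * B₁) / Λ ^ 2) * (β / π) ^ 2 with hb
  set c : ℝ := 3 * (4 * B₁ / Λ) * (3 * (β / π)) + 18 * (β / π) ^ 2 with hc
  set a' : ℝ := (4 * B₂ + 2 * B₁) / Λ ^ 2 * (|e| * (β / π) ^ 2 + β / π) with ha'
  set b' : ℝ := 2 * (2 * B₁ / Λ) * (β / π) ^ 2 with hb'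
  set c' : ℝ := 3 * (β / π) with hc'
  refine hasDerivAt_tsum (u := fun n : ℕ => a * (2 * Λ ^ 2 / (ppFreq β n ^ 2 + Λ ^ 2)) + b * (2 * Λ ^ 2 / (ppFreq β n ^ 2 + Λ ^ 2)) +
      c * (1 / (ppFreq β n ^ 2 + 0 ^ 2)))
    (g := fun (n : ℕ) (v : ℝ) => uvWeightFn Λ (ppFreq β n) e *
      (uvWeightFnD2 Λ (ppFreq β n) v * (e / (ppFreq β n ^ 2 + e ^ 2) + v / (ppFreq β n ^ 2 + v ^ 2)) +
        2 * uvWeightFnD1 Λ (ppFreq β n) v * ((ppFreq β n ^ 2 - v ^ 2) / (ppFreq β n ^ 2 + v ^ 2) ^ 2) +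
        uvWeightFn Λ (ppFreq β n) v * (2 * v * (v ^ 2 - 3 * ppFreq β n ^ 2) / (ppFreq β n ^ 2 + v ^ 2) ^ 3)))
    (g' := fun (n : ℕ) (v : ℝ) => uvWeightFn Λ (ppFreq β n) e *
      (uvWeightFnD3 Λ (ppFreq β n) v * (e / (ppFreq β n ^ 2 + e ^ 2) + v / (ppFreq β n ^ 2 + v ^ 2)) +
        3 * uvWeightFnD2 Λ (ppFreq β n) v * ((ppFreq β n ^ 2 - v ^ 2) / (ppFreq β n ^ 2 + v ^ 2) ^ 2) +
        3 * uvWeightFnD1 Λ (ppFreq β n) v * (2 * v * (v ^ 2 - 3 * ppFreq β n ^ 2) / (ppFreq β n ^ 2 + v ^ 2) ^ 3) +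
        uvWeightFn Λ (ppFreq β n) v * ((36 * ppFreq β n ^ 2 * v ^ 2 - 6 * v ^ 4 - 6 * ppFreq β n ^ 4) / (ppFreq β n ^ 2 + v ^ 2) ^ 4)))
    (summable_ppD2Dominator hβ a b c) (fun n v => ?_) (fun n v => ?_) (y₀ := u) ?_ u
  · -- termwise derivative
    have hne : ppFreq β n ^ 2 + v ^ 2 ≠ 0 := by have := hω n; positivity
    have hW : HasDerivAt (fun y => uvWeightFn Λ (ppFreq β n) y) (uvWeightFnD1 Λ (ppFreq β n) v) v := hasDerivAt_uvWeightFn Λ (ppFreq β n) v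
    have hW1 : HasDerivAt (fun y => uvWeightFnD1 Λ (ppFreq β n) y) (uvWeightFnD2 Λ (ppFreq β n) v) v := hasDerivAt_uvWeightFnD1 Λ (ppFreq β n) v
    have hW2 : HasDerivAt (fun y => uvWeightFnD2 Λ (ppFreq β n) y) (uvWeightFnD3 Λ (ppFreq β n) v) v := hasDerivAt_uvWeightFnD2 Λ (ppFreq β n) v
    have hL : HasDerivAt (fun y : ℝ => y / (ppFreq β n ^ 2 + y ^ 2)) ((ppFreq β n ^ 2 - v ^ 2) / (ppFreq β n ^ 2 + v ^ 2) ^ 2) v :=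
      hasDerivAt_lorentzian (ppFreq β n) hne
    have hL' := hasDerivAt_lorentzian_deriv (ppFreq β n) hne
    have hL'' := hasDerivAt_lorentzian_deriv2 (ppFreq β n) hne
    have h := (((hW2.fun_mul (hL.const_add (e / (ppFreq β n ^ 2 + e ^ 2)))).fun_add ((hW1.fun_mul hL').const_mul 2)).fun_add (hW.fun_mul hL'')).const_mul
      (uvWeightFn Λ (ppFreq β n) e)
    refine (h.congr_of_eventuallyEq (Eventually.of_forall fun y => by ring)).congr_deriv ?_
    ring
  · -- the dominator
    rw [Real.norm_eq_abs]
    exact abs_ppDuuuSummand_le hβ hΛ hB₁ hB₂ hB₃ e v n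
  · -- summability of the second-derivative series at `u`
    exact Summable.of_norm_bounded (summable_ppD2Dominator hβ a' b' c') fun n => by
      rw [Real.norm_eq_abs]
      exact abs_ppDuuSummand_le hβ hΛ hB₁ hB₂ e u n

end Summit.HubbardSuperconductivity.HubbardSuperconductivity.Theorems.C4a

end
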